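import Literature.AlgebraicGeometry.HodgeTheory.HolomorphicBundleChernCharacterProofs
import Literature.AlgebraicGeometry.Motives.AnalytificationTautologicalBundle
import Literature.AlgebraicGeometry.Motives.KaehlerTopologyOmegaPowProofs
import Literature.AlgebraicGeometry.Motives.ComplexPointsOrientation
import Literature.AlgebraicTopology.SingularHomology.CohomologyOfPoint
import Literature.NumberTheory.Transcendental.ComplexDeRhamRealStructure
import Literature.Geometry.Kaehler.KaehlerMetricOfPositiveForm
import HarnessLib

/-!
# Chern characters of holomorphic bundles: the top degree `p = dim X` (Voisin I, Thm. 11.32 ⊗ ℂ) and curves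

Family `hodge`, layer `Literature/AlgebraicGeometry/HodgeTheory`. Third proofs file of
`HolomorphicBundleChernCharacter` (the named fact
`span_holomorphicBundleChernCharacter_eq_algebraicClasses`, Voisin I Thm. 11.32 tensored with `ℂ`:
for `X` smooth projective, `span_ℂ {ch_p(E) : E holomorphic on X^an} = Nᵖ H²ᵖ(X(ℂ); ℂ)`), after
`HolomorphicBundleChernCharacterProofs` (degrees `p = 0`, `p > dim X`, and `dim X = 0`). Here the
**top degree `p = n = dim X ≥ 1`** is PROVED, and with it the fact for CURVES (all degrees):

* `HodgeModel.exists_mem_chernCharacterSet_tautologicalBundle_ne_zero` — for `p ≤ n` the `p`-th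
  Chern character of the tautological line bundle `𝒪(-1)|_{X^an}` (restriction of `𝒪_{ℙᴺ}(-1)`
  along a projective embedding, `AnalytificationTautologicalBundle`) is NON-ZERO in `H²ᵖ(X(ℂ); ℂ)`:
  with the Chern connection of the metric induced by `ℂᴺ⁺¹` its Chern character form is
  `ch_p(𝒪(-1), D) = (1/p!) (-θ/2π)ᵖ` globally (`isChernCharacterForm_tautologicalConnection`), `θ` the
  restricted Fubini–Study form — a Kähler form (`GAGAKaehlerImmersionProofs`, Voisin §3.3.2) — and
  `[θ]ᵖ ≠ 0` in `H²ᵖ_dR` for `p ≤ n` on the compact Kähler manifold `X^an` (Voisin I, Cor. 3.9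
  rephrased: the tree's `kaehlerFormPow_deRhamCohomology_mk_ne_zero`, via `∫ θⁿ > 0` and Stokes);
  complexification `H_dR(ℝ) → H_dR(ℂ)` is injective and the comparisons `A.deRham`, `A.pullback` are
  isomorphisms. (Voisin I, §11.2 with Lemma 3.16 / Thm. 3.13: `c₁(𝒪_{ℙⁿ}(1)) = [ω_FS]`, the positive
  generator; Thm. 7.14 / Lemma 7.29: its powers generate `H^{2k}(ℙⁿ)`.)
* `span_holomorphicBundleChernCharacter_eq_top_of_degree_top`,
  `span_holomorphicBundleChernCharacter_eq_algebraicClasses_of_degree_top` — **Thm. 11.32 ⊗ ℂ in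
  degree `2n`**: `H²ⁿ(X(ℂ); ℂ)` is a line (`dim H²ⁿ = dim H⁰ = 1`, Poincaré duality on the closed
  connected `2n`-manifold `X(ℂ)`, Hatcher Cor. 3.37), spanned by `ch_n(𝒪(-1)) ≠ 0`, and equal to
  `algebraicClasses X n` (every top class is supported on a point, `mem_algebraicClasses_of_degree_top`).
* `span_holomorphicBundleChernCharacter_eq_algebraicClasses_of_dim_le_one` — hence **the fact HOLDS
  for `dim X ≤ 1`** (points and smooth projective curves) in every degree.

All statements are theorems; no definitions, no named facts.

## References

* C. Voisin, *Hodge Theory and Complex Algebraic Geometry I* (CUP 2002), Thm. 11.32, §11.2,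
  §3.1.3 Cor. 3.9, §3.3.2 Lemma 3.16, Thm. 3.13, §7.1 Thm. 7.14. [VoisinHodgeI2002]
* S. Kobayashi, *Differential Geometry of Complex Vector Bundles* (1987), Ch. II §2 (2.21),
  Thm. 2.16. [Kobayashi1987]
* P. Griffiths, J. Harris, *Principles of Algebraic Geometry* (1978), pp. 30–31, 73, 141–145.
  [GriffithsHarris1978]
* A. Hatcher, *Algebraic Topology* (CUP 2002), §3.3 Cor. 3.37, §3.1 p. 199. [HatcherAT2002]
-/

noncomputable section

open scoped Manifold ContDiff
open CategoryTheory AlgebraicGeometry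
open Literature.Geometry.Kaehler
open Literature.NumberTheory.Transcendental
open Literature.AlgebraicGeometry.Motives (kaehlerFormPow isSmoothForm_kaehlerFormPow
  isClosedForm_kaehlerFormPow kaehlerFormPow_deRhamCohomology_mk_ne_zero)
open Literature.AlgebraicGeometry.Motives.AnalytificationKaehler

namespace Literature.AlgebraicGeometry.HodgeTheory

section HodgeTheory

open Literature.AlgebraicTopology.SingularHomology

variable {n : ℕ} {X : Motives.SchemeOver ℂ}

/-! ### The Kähler metric of the restricted Fubini–Study form on a Hodge model -/

/-- **The restricted Fubini–Study form of a projective embedding is the Kähler form of a Kähler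
metric on the Hodge model** (`X` smooth projective): `θ = fubiniStudyPullbackForm` is smooth, closed,
of type `(1,1)` and positive (`GAGAKaehlerImmersionProofs`; Voisin (2002), §3.3.2 Lemma 3.16 and p. 77),
so `g(v, w) = θ(v, Jw)` is a smooth Kähler metric with `ω_g = θ`
(`exists_isKaehler_kaehlerForm_eq_of_closed_positive_form`, Voisin §3.1.1 Lemma 3.3).
[cite: VoisinHodgeI2002, §3.3.2 Lemma 3.16 and p. 77] -/
theorem HodgeModel.exists_isKaehler_kaehlerForm_eq_fubiniStudyPullbackForm
    (hX : Motives.IsSmoothProjective n X) {N : ℕ} (ι : X ⟶ Motives.projectiveSpace N ℂ)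
    [IsClosedImmersion ι.left] (A : HodgeModel n X) :
    ∃ g : Bundle.ContMDiffRiemannianMetric 𝓘(ℝ, A.model) ∞ A.model
        (fun x : A.carrier ↦ TangentSpace 𝓘(ℝ, A.model) x),
      g.toRiemannianMetric.IsKaehler ∧
        g.toRiemannianMetric.kaehlerForm = fubiniStudyPullbackForm A.model ι A.toComplexPoints := by
  haveI := hX.smoothOfRelativeDimension
  exact exists_isKaehler_kaehlerForm_eq_of_closed_positive_form _
    (isSmoothForm_fubiniStudyPullbackForm A.isAnalytification)
    (isClosedForm_fubiniStudyPullbackForm A.isAnalytification)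
    (fubiniStudyPullbackForm_tangentJ A.isAnalytification)
    (fubiniStudyPullbackForm_pos A.isAnalytification)

/-! ### The global Chern character forms of `𝒪(-1)|_{X^an}` and their classes -/

/-- The normalising constant `(1/p!) (-1/2π)ᵖ` of `ch_p(𝒪(-1), D)` is non-zero. [folklore] -/
theorem tautological_chernCharacter_const_ne_zero (p : ℕ) :
    ((p.factorial : ℂ)⁻¹ * (-(2 * (Real.pi : ℂ))⁻¹) ^ p) ≠ 0 :=
  mul_ne_zero (inv_ne_zero (by exact_mod_cast p.factorial_ne_zero))
    (pow_ne_zero _ (neg_ne_zero.2 (inv_ne_zero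
      (mul_ne_zero two_ne_zero (Complex.ofReal_ne_zero.2 Real.pi_ne_zero)))))

section Tautological

variable {N : ℕ} (ι : X ⟶ Motives.projectiveSpace N ℂ) [IsClosedImmersion ι.left] (A : HodgeModel n X)
  (g : Bundle.ContMDiffRiemannianMetric 𝓘(ℝ, A.model) ∞ A.model
    (fun x : A.carrier ↦ TangentSpace 𝓘(ℝ, A.model) x))

/-- **`ch_p(𝒪(-1)|_{X^an}, D) = (1/p!) (-ω_g/2π)ᵖ` globally**: for any smooth metric `g` on the
Hodge model whose Kähler form is the restricted Fubini–Study form `θ`, the global form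
`(1/p!) (-1/2π)ᵖ ω_gᵖ ⊗ 1` is a `p`-th Chern character form of the tautological cocycle with its
Fubini–Study (Chern) connection — on each chart `Mⱼ` it is `(1/p!) tr((-Ωⱼ/2πi)ᵖ)`
(`chernCharacterForm_tautologicalConnection_apply`; Kobayashi (1987), Ch. II (2.21); Voisin (2002),
Lemma 3.16: `c₁(𝒪(-1)) = -[ω_FS]`). [cite: Kobayashi1987, Ch. II §2 (2.21)] -/
theorem HodgeModel.isChernCharacterForm_tautologicalConnection
    (hg : g.toRiemannianMetric.kaehlerForm = fubiniStudyPullbackForm A.model ι A.toComplexPoints) (p : ℕ) :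
    (tautologicalConnection ι A.isAnalytification).IsChernCharacterForm p
      (((p.factorial : ℂ)⁻¹ * (-(2 * (Real.pi : ℂ))⁻¹) ^ p) •
        (kaehlerFormPow g.toRiemannianMetric p).ofReal) := by
  intro j m hm
  rw [chernCharacterForm_tautologicalConnection_apply ι A.isAnalytification g.toRiemannianMetric hm
    (congrFun hg m) p]
  rfl

/-- The forms `c · ω_gᵖ ⊗ 1` are smooth (powers of the Kähler form of a smooth metric are smooth,
`isSmoothForm_kaehlerFormPow`). [cite: VoisinHodgeI2002, §3.1] -/
theorem HodgeModel.isSmoothForm_smul_kaehlerFormPow_ofReal (c : ℂ) (p : ℕ) :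
    IsSmoothForm (c • (kaehlerFormPow g.toRiemannianMetric p).ofReal) := by
  haveI : WedgeFacts 𝓘(ℝ, A.model) A.carrier ℝ :=
    wedgeFacts_of_assoc 𝓘(ℝ, A.model) A.carrier ℝ (ContinuousAlternatingMap.WedgeAssoc_holds ℝ A.model ℝ)
  exact (isSmoothForm_kaehlerFormPow (isSmoothForm_kaehlerForm_of_isManifold_complex_holds
    (E := A.model) (M := A.carrier)) g p).ofReal.smul_complex c

/-- The forms `c · ω_gᵖ ⊗ 1` are closed when `g` is Kähler (`dω = 0`, Leibniz;
`isClosedForm_kaehlerFormPow`, `d` commutes with `⊗ 1` and with complex scalars).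
[cite: VoisinHodgeI2002, §3.1.2 Def. 3.6] -/
theorem HodgeModel.isClosedForm_smul_kaehlerFormPow_ofReal (hgK : g.toRiemannianMetric.IsKaehler)
    (c : ℂ) (p : ℕ) : IsClosedForm (c • (kaehlerFormPow g.toRiemannianMetric p).ofReal) := by
  haveI : WedgeFacts 𝓘(ℝ, A.model) A.carrier ℝ :=
    wedgeFacts_of_assoc 𝓘(ℝ, A.model) A.carrier ℝ (ContinuousAlternatingMap.WedgeAssoc_holds ℝ A.model ℝ)
  have hK : mextDeriv (kaehlerFormPow g.toRiemannianMetric p) = 0 :=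
    isClosedForm_kaehlerFormPow (isSmoothForm_kaehlerForm_of_isManifold_complex_holds
      (E := A.model) (M := A.carrier)) g hgK p
  rw [IsClosedForm, mextDeriv_smul_complex_holds, MForm.mextDeriv_ofReal_holds, hK, MForm.ofReal_zero,
    smul_zero]

/-- The powers of the Kähler form of a Kähler metric are closed smooth real forms (membership
form). [cite: VoisinHodgeI2002, §3.1.2] -/
theorem HodgeModel.kaehlerFormPow_mem_closedSmoothForms (hgK : g.toRiemannianMetric.IsKaehler) (p : ℕ) :
    kaehlerFormPow g.toRiemannianMetric p ∈ closedSmoothForms 𝓘(ℝ, A.model) A.carrier ℝ (2 * p) := by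
  haveI : WedgeFacts 𝓘(ℝ, A.model) A.carrier ℝ :=
    wedgeFacts_of_assoc 𝓘(ℝ, A.model) A.carrier ℝ (ContinuousAlternatingMap.WedgeAssoc_holds ℝ A.model ℝ)
  have hω := isSmoothForm_kaehlerForm_of_isManifold_complex_holds (E := A.model) (M := A.carrier)
  exact (mem_closedSmoothForms_iff _).2
    ⟨isSmoothForm_kaehlerFormPow hω g p, isClosedForm_kaehlerFormPow hω g hgK p⟩

/-- **The class of `c · ω_gᵖ ⊗ 1` is `c · ([ω_g]ᵖ ⊗ 1)`, non-zero for `c ≠ 0` and `p ≤ dim X`**: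
`[ω_g]ᵖ ≠ 0` in `H²ᵖ_dR(M; ℝ)` on the non-empty compact Kähler manifold `M ≅ X^an` (Voisin (2002),
Cor. 3.9 rephrased — the tree's `kaehlerFormPow_deRhamCohomology_mk_ne_zero`, `dim_ℂ = n`), and
complexification `H_dR(M; ℝ) → H_dR(M; ℂ)` is injective (`complexDeRhamCohomology.ofReal_injective`).
[cite: VoisinHodgeI2002, §3.1.3 Cor. 3.9] -/
theorem HodgeModel.mk_smul_kaehlerFormPow_ofReal_ne_zero (hX : Motives.IsSmoothProjective n X)
    (hgK : g.toRiemannianMetric.IsKaehler) {c : ℂ} (hc : c ≠ 0) {p : ℕ} (hp : p ≤ n) :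
    complexDeRhamCohomology.mk A.model A.carrier (2 * p)
        ⟨c • (kaehlerFormPow g.toRiemannianMetric p).ofReal,
          mem_cclosedSmoothForms (A.isSmoothForm_smul_kaehlerFormPow_ofReal g c p)
            (A.isClosedForm_smul_kaehlerFormPow_ofReal g hgK c p)⟩ ≠ 0 := by
  haveI := A.nonempty_carrier hX
  haveI : CompactSpace A.carrier := by
    haveI := Motives.ComplexPoints.compactSpace_of_isSmoothProjective hX
    exact A.isAnalytification.homeomorph.symm.compactSpace
  have hcl := A.kaehlerFormPow_mem_closedSmoothForms g hgK p
  have hne := kaehlerFormPow_deRhamCohomology_mk_ne_zero g hgK (k := p)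
    (by rw [A.isAnalytification.finrank_eq]; exact hp) hcl
  have key : complexDeRhamCohomology.mk A.model A.carrier (2 * p)
      ⟨c • (kaehlerFormPow g.toRiemannianMetric p).ofReal,
        mem_cclosedSmoothForms (A.isSmoothForm_smul_kaehlerFormPow_ofReal g c p)
          (A.isClosedForm_smul_kaehlerFormPow_ofReal g hgK c p)⟩ =
      c • complexDeRhamCohomology.ofReal A.model A.carrier (2 * p)
        (deRhamCohomology.mk ⟨kaehlerFormPow g.toRiemannianMetric p, hcl⟩) := by
    rw [complexDeRhamCohomology.ofReal_mk, ← LinearMap.map_smul]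
    rfl
  rw [key]
  refine smul_ne_zero hc fun h0 ↦ hne (complexDeRhamCohomology.ofReal_injective ?_)
  rw [h0, map_zero]

/-- **`ch_p(𝒪(-1)|_{X^an}) ≠ 0` in `H²ᵖ(X(ℂ); ℂ)` for `p ≤ dim X`.** For `X` smooth projective with a
closed immersion `ι : X ⟶ ℙᴺ`, a Hodge model `A` and `p ≤ n`, the Chern character set of the
tautological cocycle `𝒪(-1)|_{X^an}` contains a non-zero class: the class `c` with
`A.pullback c = A.deRham [(1/p!) (-θ/2π)ᵖ]`, `θ` the restricted Fubini–Study form, which is the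
comparison image of the class of a global `p`-th Chern character form of the Fubini–Study connection
and is non-zero since `[θ]ᵖ ≠ 0` (Voisin (2002), Cor. 3.9; Lemma 3.16 / Thm. 3.13 and §11.2:
`c₁(𝒪(1)) = [ω_FS]`; Thm. 7.14: `hⁱ ≠ 0`). [cite: VoisinHodgeI2002, §3.3.2 Lemma 3.16 and §3.1.3 Cor. 3.9] -/
theorem HodgeModel.exists_mem_chernCharacterSet_tautologicalBundle_ne_zero
    (hX : Motives.IsSmoothProjective n X) {p : ℕ} (hp : p ≤ n) :
    ∃ c ∈ A.chernCharacterSet (tautologicalBundle ι A.isAnalytification) p, c ≠ 0 := by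
  obtain ⟨g, hgK, hg⟩ := A.exists_isKaehler_kaehlerForm_eq_fubiniStudyPullbackForm hX ι
  have hs := A.isSmoothForm_smul_kaehlerFormPow_ofReal g
    ((p.factorial : ℂ)⁻¹ * (-(2 * (Real.pi : ℂ))⁻¹) ^ p) p
  have hcl := A.isClosedForm_smul_kaehlerFormPow_ofReal g hgK
    ((p.factorial : ℂ)⁻¹ * (-(2 * (Real.pi : ℂ))⁻¹) ^ p) p
  have hne := A.mk_smul_kaehlerFormPow_ofReal_ne_zero g hX hgK (tautological_chernCharacter_const_ne_zero p) hp
  obtain ⟨c, hc⟩ := A.pullback_surjective (2 * p)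
    (A.deRham A.carrier (2 * p) (complexDeRhamCohomology.mk A.model A.carrier (2 * p)
      ⟨_, mem_cclosedSmoothForms hs hcl⟩))
  refine ⟨c, ⟨tautologicalConnection ι A.isAnalytification, _, hs, hcl,
    A.isChernCharacterForm_tautologicalConnection ι g hg p, hc⟩, fun h0 ↦ hne ?_⟩
  rw [h0, map_zero] at hc
  exact (LinearEquiv.map_eq_zero_iff _).1 hc.symm

/-- Hence, for `X` smooth projective with a Hodge model `A` and `p ≤ dim X`, **some holomorphic
vector bundle on `X^an` has `ch_p ≠ 0` in `H²ᵖ(X(ℂ); ℂ)`** (the line bundle `𝒪(-1)|_{X^an}` of any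
projective embedding). [cite: VoisinHodgeI2002, §11.2 and §3.3.2 Lemma 3.16] -/
theorem HodgeModel.exists_mem_holomorphicBundleChernCharacter_ne_zero
    (hX : Motives.IsSmoothProjective n X) (A : HodgeModel n X) {p : ℕ} (hp : p ≤ n) :
    ∃ c ∈ A.holomorphicBundleChernCharacter p, c ≠ 0 := by
  obtain ⟨N, ι, hι⟩ := hX.isProjectiveOver
  obtain ⟨c, hc, hc0⟩ := A.exists_mem_chernCharacterSet_tautologicalBundle_ne_zero ι hX hp
  exact ⟨c, A.chernCharacterSet_subset_holomorphicBundleChernCharacter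
    (tautologicalBundle_isHolomorphic ι A.isAnalytification) p hc, hc0⟩

end Tautological

/-! ### Thm. 11.32 ⊗ ℂ in the top degree, and for curves -/

/-- `X(ℂ)` is path connected for `X` smooth projective (connected — irreducible varieties are
connected in the complex topology, SGA1 XII Prop. 2.4, the tree's `connectedSpace_complexPoints` — and
locally path connected, being a topological manifold). [cite: SGA1, Exp. XII Prop. 2.4] -/
theorem pathConnectedSpace_complexPoints_of_isSmoothProjective (hX : Motives.IsSmoothProjective n X) :
    PathConnectedSpace (Motives.ComplexPoints X) := by
  letI := hX.chartedSpace
  haveI := connectedSpace_complexPoints hX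
  haveI : LocallyPathConnectedSpace (Motives.ComplexPoints X) :=
    ChartedSpace.locallyPathConnectedSpace (EuclideanSpace ℝ (Fin (2 * n))) (Motives.ComplexPoints X)
  exact pathConnectedSpace_iff_connectedSpace.mpr ‹_›

/-- **`H²ⁿ(X(ℂ); ℂ)` is a line** for `X` smooth projective of dimension `n`:
`dim H²ⁿ = dim H⁰ = 1` (Poincaré duality for the closed `ℂ`-oriented `2n`-manifold `X(ℂ)`, Hatcher
Cor. 3.37 — the tree's `Motives.ComplexPoints.finrank_singularCohomology_eq_of_add_eq` — and
`H⁰ ≅ ℂ` for the path-connected `X(ℂ)`, Hatcher §3.1 p. 199). [cite: HatcherAT2002, §3.3 Cor. 3.37] -/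
theorem finrank_complexBetti_two_mul_eq_one (hX : Motives.IsSmoothProjective n X) :
    Module.finrank ℂ (complexBetti X (2 * n)) = 1 := by
  haveI := pathConnectedSpace_complexPoints_of_isSmoothProjective hX
  change Module.finrank ℂ (singularCohomology ℂ ℂ (Motives.ComplexPoints X) (2 * n)) = 1
  rw [Motives.ComplexPoints.finrank_singularCohomology_eq_of_add_eq ℂ hX
    (show 2 * n + 0 = 2 * n by omega),
    (singularCohomologyZeroEquiv ℂ ℂ (Motives.ComplexPoints X)).finrank_eq, Module.finrank_self]

/-- **The Chern characters of holomorphic bundles span `H²ⁿ(X(ℂ); ℂ)`** (`n = dim X`): the line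
`H²ⁿ(X(ℂ); ℂ)` is spanned by the non-zero class `ch_n(𝒪(-1)|_{X^an})`
(`exists_mem_holomorphicBundleChernCharacter_ne_zero`). Voisin (2002), Thm. 11.32 in degree `2n`
(with Thm. 7.14: `hⁿ` generates `H²ⁿ(ℙⁿ)`). [cite: VoisinHodgeI2002, Thm. 11.32] -/
theorem span_holomorphicBundleChernCharacter_eq_top_of_degree_top (hX : Motives.IsSmoothProjective n X)
    (A : HodgeModel n X) : Submodule.span ℂ (A.holomorphicBundleChernCharacter n) = ⊤ := by
  obtain ⟨c, hc, hc0⟩ := A.exists_mem_holomorphicBundleChernCharacter_ne_zero hX le_rfl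
  have h1 := finrank_complexBetti_two_mul_eq_one hX
  haveI : FiniteDimensional ℂ (complexBetti X (2 * n)) := Module.finite_of_finrank_eq_succ h1
  have hspan : (ℂ ∙ c) = ⊤ :=
    Submodule.eq_top_of_finrank_eq (by rw [finrank_span_singleton hc0, h1])
  exact eq_top_iff.2 (hspan ▸ Submodule.span_mono (Set.singleton_subset_iff.2 hc))

/-- **Voisin I, Thm. 11.32 ⊗ ℂ in the top degree (proved).** For `X` smooth projective of dimension
`n ≥ 1` with a Hodge model `A`, the `ℂ`-span of the `n`-th Chern characters of the holomorphic vector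
bundles on `X^an` equals `algebraicClasses X n = Nⁿ H²ⁿ(X(ℂ); ℂ)`: both are all of `H²ⁿ(X(ℂ); ℂ)`
— the left side by `span_holomorphicBundleChernCharacter_eq_top_of_degree_top` (`ch_n(𝒪(-1)) ≠ 0`
spans the line `H²ⁿ`), the right side because every top-degree class is supported on a point
(`mem_algebraicClasses_of_degree_top`, Voisin I §11.1.2). [cite: VoisinHodgeI2002, Thm. 11.32] -/
theorem span_holomorphicBundleChernCharacter_eq_algebraicClasses_of_degree_top
    (hX : Motives.IsSmoothProjective n X) (A : HodgeModel n X) (hn : 1 ≤ n) :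
    Submodule.span ℂ (A.holomorphicBundleChernCharacter n) = algebraicClasses X n := by
  rw [span_holomorphicBundleChernCharacter_eq_top_of_degree_top hX A, eq_comm, eq_top_iff]
  exact fun c _ ↦ mem_algebraicClasses_of_degree_top hX hn c

/-- **Voisin I, Thm. 11.32 ⊗ ℂ for points and curves (proved): the named fact
`span_holomorphicBundleChernCharacter_eq_algebraicClasses` HOLDS whenever `dim X ≤ 1`**, in every
degree `p`: `p = 0` by `span_holomorphicBundleChernCharacter_zero` (`ch₀ = rank` spans `H⁰`),
`p = n = 1` by the top-degree case, and `p > n` because `H²ᵖ(X(ℂ); ℂ) = 0`.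
[cite: VoisinHodgeI2002, Thm. 11.32] -/
theorem span_holomorphicBundleChernCharacter_eq_algebraicClasses_of_dim_le_one
    (hX : Motives.IsSmoothProjective n X) (hn : n ≤ 1) (A : HodgeModel n X) (p : ℕ) :
    Submodule.span ℂ (A.holomorphicBundleChernCharacter p) = algebraicClasses X p := by
  rcases Nat.lt_or_ge n p with hp | hp
  · exact span_holomorphicBundleChernCharacter_eq_algebraicClasses_of_lt hX A hp
  obtain rfl | rfl : n = 0 ∨ n = 1 := by omega
  · exact span_holomorphicBundleChernCharacter_eq_algebraicClasses_of_dim_zero hX A p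
  · obtain rfl | rfl : p = 0 ∨ p = 1 := by omega
    · exact span_holomorphicBundleChernCharacter_zero hX A
    · exact span_holomorphicBundleChernCharacter_eq_algebraicClasses_of_degree_top hX A le_rfl

end HodgeTheory

end Literature.AlgebraicGeometry.HodgeTheory

end
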